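import Literature.AnabelianGeometry.EtaleTheta.SettingModelChiThetaCusp
import Literature.AnabelianGeometry.EtaleTheta.SettingModelChiCuspGroupLevel
import Literature.AnabelianGeometry.EtaleTheta.SettingModelChiCensusClauses
import Literature.AnabelianGeometry.EtaleTheta.SettingBridge
import HarnessLib

/-!
# The NAMED cusped χ-root `ThetaSetting.modelχ′ p` (abc-iut-w5-d029's F5c): its parameter bundle `OncePuncturedData` is
# INHABITED with no binder; the bridge to `OncePuncturedTemperedGroup ℚ_p`; a binder of the §2 census eliminated (proof-only)

Mochizuki, *The étale theta function …*, Publ. RIMS **45** (2009) [EtTh], §1, PRIMS pp. 237–239 [cite: MochizukiEtTh2009, §1 p.13];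
*Semi-graphs of anabelioids* [SemiAnbd], Ex. 3.10 pp. 43–45 [cite: MochizukiSemiAnbd2006, Ex 3.10 p.45].  abc-iut cell, seat
abc-iut-w5-d111 (gen 4); R78 cluster, F5c consumer side.  PROOF-ONLY (0 definitions).  This seat's `SettingModelChiCuspTheta`
(p434001) inhabited `OncePuncturedData` over an ANONYMOUS cusped root (`modelχ` updated along `curveχ′` inside the proof);
abc-iut-w5-d029's F5c `SettingModelChiThetaCusp` (p433756) gives that root a NAME, `ThetaSetting.modelχ′ p`, with the
clauses (P1)–(P4), the guard and `hYcl` as lemmas.  Here the bundle is re-assembled AT THE NAMED RECORD, so that consumers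
that bind `(e : (ThetaSetting.modelχ′ p).OncePuncturedData)` can take `(nonempty_oncePuncturedData_modelχ' p).some`:

* **`nonempty_oncePuncturedData_modelχ'`** — `Nonempty (ThetaSetting.modelχ′ p).OncePuncturedData` ((P1) `ker_augHat_modelχ'`,
  (P2) `exists_isCusp_modelχ'`, (P3) `decomp_modelχ'_le_ker_toZ`, (P4) `map_aug_decomp_modelχ'`, (P5) `modelχ'_isEtThOrigin`
  — all abc-iut-w5-d029's; the η′ `GroupLevelData` — this seat's `nonempty_groupLevelData_curveχ'_holds`);
* **`exists_oncePuncturedTemperedGroup_modelχ'`** — through abc-iut-L2's bridge: an `OncePuncturedTemperedGroup` over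
  `K = ℚ_p` with `Π = Π^tp_X` of `modelχ′`, `zQuot = toZ`, and cusp family = `modelχ′`'s `cuspDecompFamily` (the
  `Π^tp_X`-conjugates of `b^Ẑ ⋊ G_{ℚ_p}`, a non-trivial torsor by this seat's `not_normal_cuspDecompχ`, p436447;
  `cuspDecomp_toOncePuncturedTemperedGroup_modelχ'`);
* `not_hIx_modelχ'_of_piCData` — the binder `(e : OncePuncturedData)` of `SettingModelChiCensusClauses.not_hIx_modelχ'`
  ELIMINATED: for every profinite input bundle `I` over `modelχ′` and every `l ≥ 2` the §1-side hIx clause fails.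
HONEST LABEL: semi-synthetic model — consistency evidence only; nothing of [EtTh]/[SemiAnbd] asserted; no side taken on
[IUTchIII] Cor. 3.12.
-/

noncomputable section

namespace Literature.AnabelianGeometry.EtaleTheta.SettingModel

open Literature.AnabelianGeometry.SemiGraphs Literature.AlgebraicGeometry.Frobenioids _root_.Topology

variable (p : ℕ) [Fact p.Prime]

/-- **`OncePuncturedData` of the named cusped χ-root `ThetaSetting.modelχ′ p` is inhabited — no binder.**
[cite: MochizukiEtTh2009, §1 p.13] -/
theorem nonempty_oncePuncturedData_modelχ' : Nonempty (ThetaSetting.modelχ' p).OncePuncturedData :=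
  ⟨{ toGroupLevelData := (nonempty_groupLevelData_curveχ'_holds p).some
     ker_augHat := ker_augHat_modelχ' p
     exists_cusp := exists_isCusp_modelχ' p
     decomp_le_ker_toZ := fun x _ => decomp_modelχ'_le_ker_toZ p x
     map_aug_decomp := fun x _ => map_aug_decomp_modelχ' p x
     origin := ThetaSetting.modelχ'_isEtThOrigin p }⟩

/-- The full root package at the named record: guard, `hYcl`, `aug` open, and the bundle.
[cite: MochizukiEtTh2009, §1 p.13] -/
theorem modelχ'_root_package :
    (ThetaSetting.modelχ' p).IsEtThOrigin ∧
      ((ThetaSetting.modelχ' p).DtpY.map (ThetaSetting.modelχ' p).toHat.toMonoidHom).topologicalClosure ≤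
        (ThetaSetting.modelχ' p).DtpY.map (ThetaSetting.modelχ' p).toHat.toMonoidHom ⊔
          (⁅⁅(ThetaSetting.modelχ' p).DeltaHat, (ThetaSetting.modelχ' p).DeltaHat⁆,
            (ThetaSetting.modelχ' p).DeltaHat⁆).topologicalClosure ∧
      IsOpenMap (ThetaSetting.modelχ' p).aug ∧ Nonempty (ThetaSetting.modelχ' p).OncePuncturedData :=
  ⟨ThetaSetting.modelχ'_isEtThOrigin p, hYcl_modelχ' p, isOpenMap_aug_modelχ' p,
    nonempty_oncePuncturedData_modelχ' p⟩

/-- **`OncePuncturedTemperedGroup ℚ_p` from the named cusped χ-root** (abc-iut-L2's bridge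
`ThetaSetting.toOncePuncturedTemperedGroup`): `Π = Π^tp_X = Γ ⋊_χ G_{ℚ_p}`, `zQuot = toZ` (the degree), cusp family =
`cuspDecompFamily` = the `Π^tp_X`-conjugacy class of `b^Ẑ ⋊ G_{ℚ_p}`. [cite: MochizukiEtTh2009, §1 pp.237-239] -/
theorem exists_oncePuncturedTemperedGroup_modelχ' :
    ∃ T : OncePuncturedTemperedGroup (ThetaSetting.modelχ' p).K, T.Pi = (ThetaSetting.modelχ' p).PiTemp :=
  ⟨(ThetaSetting.modelχ' p).toOncePuncturedTemperedGroup (nonempty_oncePuncturedData_modelχ' p).some, rfl⟩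

/-- … and its cusp family IS `modelχ′`'s `cuspDecompFamily` (the bridge's field, by construction) — stated for the
explicit witness. [cite: MochizukiEtTh2009, §1 pp.237-239] -/
theorem cuspDecomp_toOncePuncturedTemperedGroup_modelχ' :
    ((ThetaSetting.modelχ' p).toOncePuncturedTemperedGroup (nonempty_oncePuncturedData_modelχ' p).some).cuspDecomp =
      (ThetaSetting.modelχ' p).cuspDecompFamily :=
  rfl

/-- The binder `(e : (ThetaSetting.modelχ′ p).OncePuncturedData)` of abc-iut's `not_hIx_modelχ'`
(SettingModelChiCensusClauses) ELIMINATED: for every profinite input bundle `I` over `modelχ′`, every `l ≥ 2` and every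
point, the §1-side hIx clause is false. [cite: MochizukiEtTh2009, Def 2.1 p.35] -/
theorem not_hIx_modelχ'_of_piCData (l : ℕ) (hl : 2 ≤ l) {PiC : Type} [Group PiC] [TopologicalSpace PiC]
    [IsTopologicalGroup PiC] [T2Space PiC] (I : (ThetaSetting.modelχ' p).PiCData PiC)
    (x : (ThetaSetting.modelχ' p).Pt) :
    ¬ ((I.Dx x ⊓ I.augGK.ker) ⊔ I.barKer l = I.barTheta l) :=
  not_hIx_modelχ' p l hl I (nonempty_oncePuncturedData_modelχ' p).some x

end Literature.AnabelianGeometry.EtaleTheta.SettingModel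

end
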